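import Summits.QuantumFields.YangMills.Theorems.BalabanUVNodesN12TowerBoxInsideZ
import Literature.MathematicalPhysics.QuantumFieldTheory.Balaban1983to89.B15Prop1MinimiserFamilyFromThm1AtBaseCentralTower

/-!
# DAG node N12 [B15] — THE (J0′) PRODUCER OF RECORD WITHOUT ANY (0.4) GUARD: `hMin` from Theorem 1 at the base datum (tower-central, print's comb forest) at `𝐁_k(Z)` and the (2.12) class of
# record, the two per-tower guard rows DISCHARGED — the capstone of the LOCATED-E1-HSB repair (r1)+(r2)+(r3)

[Balaban1985Variational] = «[15]», Thm 1 p. 279, (2),(4) p. 278, Sect. C (45) p. 285, Prop. 8 p. 305, Sect. G pp. 305–307, Prop. 9 (190) p. 309; [Balaban1989LargeFieldI] = «[IV]», (1.74) p. 192,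
p. 193 ll. 14–20, Prop. 1 p. 194; [Balaban1989LargeFieldII] (1.9) p. 358; [Balaban1988Convergent] = «[III]», (2.2) p. 255, (2.10)–(2.13) pp. 256–257; [Balaban1987RG1] (0.4) p. 253.

Cell `pub-ymgap`, HUMAN RULINGS D-0062 ∕ D-0149, lane owner `pub-ymgap-dag-n12-c` (g24).  Key K1⁹ `stmt-QuantumFields-27364`, `--kind proof --supports … --as helper`; count-neutral.
NEW leaf; CONSUMED BY NAME, nothing modified: this lane's `B15Prop1MinimiserFamilyFromThm1AtBaseCentralTower` (the TP-twin producer, (r3) link 9∕9), `N12TowerGuardsOfClass` ((r2): the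
minimiser's guards from its class), `N12TowerBoxInsideZ` ((r2): the datum's guards from scale-`k` regularity on `Z`), r12's `B14.Eq213DetSet.Bj_of_gt`.

WHY (lane memo `N12-UNIFORMITY-SPEC.md` §6).  N12's only undischarged node-level input (J0′) `hMin` had a producer displaying two GLOBAL (0.4) guards — false for data rough off `Z`.  Steps
(r1)–(r3) rebuilt the w1 lineage's chart chain on PER-TOWER guards and (r2) inhabited those; THIS FILE plugs the two inhabitants into the twin producer at N12's record objects.

CONTENTS (namespace `Summit.QuantumFields.YangMills.BalabanUVNodes.N12MinimiserFamilyOfClassTowerGuards`; one theorem, no `def`, no `instance`, no `sorry`).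
★★★ `hMin_atRecord_of_node00Letters_thm1AtBase_central_ofClass`.

HONEST FRAMING ∕ LOCATED.  Composition by name; the displayed rows are print-shaped ((45), (β), (T1@q₀), forest, class facts, the datum's regularity on `Z`) plus the height's radius letter and
two volume-free floors; nothing of Bałaban's asserted; count-neutral helper; N12 NOT discharged (those rows are NODE 00 ∕ N07 currencies); K1⁹ NOT closed; counts unmoved; one finite 𝕋⁴
programme at fixed ε — R4 closes the conditional finite-𝕋⁴ rung `BalabanLadder.UV` only; NOT continuum ∕ OS ∕ mass gap ∕ Clay.
-/

noncomputable section

open scoped BigOperators Matrix.Norms.L2Operator Topology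

namespace Summit.QuantumFields.YangMills.BalabanUVNodes.N12MinimiserFamilyOfClassTowerGuards

open Set Metric Filter
open Literature.MathematicalPhysics.QuantumFieldTheory.Balaban1983to89
open Literature.MathematicalPhysics.QuantumFieldTheory.Balaban1983to89.Node00 (SU coeField coeField_apply SmallBelow ConstrSet constrCard constrEnum)
open T4Continuum B15DeterminingSets GaugeField
open B14.Eq213MaximalDomains (side)
open B14.Eq213DetSet (Bj Bj_of_gt maxDomT)
open B15Prop1Carrier (plaqsInside)
open B15AveragingHolomorphic (iterMh)
open B15ComplexifiedDatumFamily (conjVec)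
open B15SU2ChartHolomorphic (genE expMulC logCoordC)
open B15Prop1AnalyticExtClause (cplxVec)
open B15Prop1ChartCalculusSU2 (E3)
open B15Prop1ChartSU2 (su2Chart)
open B15ShellGauge193 (shellGauge)
open B15Extension193 (extend)
open B16Sect1Backgrounds (toMS expMul)
open ExpMeanLog (expMeanLogSU)
open BlockAveraging (blockAvg)
open T4CubeChartGnomonic (SU2)
open Literature.MathematicalPhysics.QuantumFieldTheory.BalabanImbrieJaffe1984to88.BIJ85Eq453GaugeField (qsstarGIter0)
open B15Prop1MinimiserFamilyFromThm1AtBaseCentralTower (hMin_atRecord_of_node00Letters_thm1AtBase_central_of_guardOn)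
open Summit.QuantumFields.YangMills.BalabanUVNodes.N12TowerGuardsOfClass (guardOn_towerRegion_Bj_of_mem_class)
open Summit.QuantumFields.YangMills.BalabanUVNodes.N12TowerBoxInsideZ (guardOn_towerRegion_Bj_qsstarGIter0_of_plaqSmallOn_Z)
open scoped Matrix.Norms.L2Operator

variable {F : T4Family} {k : ℕ}

/-- ★★★ **THE (J0′) PRODUCER AT N12's RECORD WITH BOTH (0.4) GUARD ROWS DISCHARGED.**  `B15Prop1MinimiserFamilyFromThm1AtBaseCentralTower.hMin_atRecord_of_node00Letters_thm1AtBase_central_of_guardOn`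
at the determining set of record `𝔹 = 𝐁_k(Z)` (hypothesis `h𝔹Z`, instantiate with `rfl`) and the class of record `U_k({Ω_j(Z)}, εreg)` (`Node00.regMSCoPOfRecord F 2 ν Kt k (maxDomT ν.M₁ Z)`):
per base field `V_k ∈ K` the per-tower guard of the MINIMISER `U₀` is read off its class (`N12TowerGuardsOfClass.guardOn_towerRegion_Bj_of_mem_class`, ρ5b's axial-gauge tower proxies transferred
by two-block locality) and the per-tower guard of the DATUM `Q_k^{s*}(ext V_k)` off the scale-`k` regularity of `ext V_k` on `Z` (`N12TowerBoxInsideZ.guardOn_towerRegion_Bj_qsstarGIter0_of_plaqSmallOn_Z`: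
[IV] p. 193 ll. 14–16 + print's collar [III] (2.13)).  DISPLAYED instead, ONCE per height: `4L ≤ M₁`, the cube divisibility, (Gᵃ) `IsBlockUnion k Z`, `0 ≤ εreg`, the radius letter `hsbU`
(∃ per height, `Node00.exists_uniform_chartCurvature_sq_bound`), the volume-free floors `6(d−1)L·εreg ≤ ρ″`, `6(d−1)Lᵏ·δ ≤ ρ″`, and PER BASE FIELD the regularity row
`PlaqSmallOn (plaqsInside (pts k Z)) δ (ext V_k)` (the road's `dist1_plaqHol_extend_shellGauge_le` output).  Every other row ((45) `hH` velocity, (β) `hposN` on the `DΦ₀(0)`-kernel,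
(T1@q₀) central, forest (F1)(F2)(F3), class facts) is the twin's VERBATIM.  AFTER THIS FILE the (J0′) producer displays NO (0.4) guard of any kind.
[cite: Balaban1985Variational, Thm 1 p.279, (2),(4) p.278, Sect. C (45) p.285, Prop. 8 p.305, Sect. G pp.305–307, Prop. 9 (190) p.309; Balaban1989LargeFieldI, (1.74) p.192, p.193 L14–20, Prop. 1 p.194; Balaban1989LargeFieldII, (1.9) p.358; Balaban1988Convergent, (2.2) p.255, (2.10)–(2.13) pp.256–257; Balaban1987RG1, (0.4) p.253] -/
theorem hMin_atRecord_of_node00Letters_thm1AtBase_central_ofClass (ν : Node00.Stage7Numerics) (Kt : ℕ) (hd : 2 ≤ (F.P Kt).d) (Z : Set (Site (F.P Kt) 0))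
    (Λ : Set (Site (F.P Kt) k)) (lo hi : Fin (F.P Kt).d → ℤ) (𝔹 : DetSet (F.P Kt)) (h𝔹Z : 𝔹 = Bj ν.M₁ Z k) (hkK : k + 1 ≤ (F.P Kt).m + (F.P Kt).K)
    -- the record geometry: `4L ≤ M₁`, the cube divisibility, `Z` a union of `k`-blocks ((Gᵃ)); the height's radius letter and the two volume-free floors
    (hM4 : 4 * (F.P Kt).L ≤ ν.M₁) (hdiv : side (F.P Kt).L ν.M₁ k ∣ (F.P Kt).sitesPerDir 0) (hZblk : B14.Eq22Determines.IsBlockUnion k Z) (hε : 0 ≤ ν.εreg)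
    {ρ'' : ℝ} (hsbU : ∀ W : GaugeField (F.P Kt) 0 SU2, ‖coeField W - 1‖ ≤ ρ'' → SmallBelow (Node00.avOfRecord F 2 Kt) k W)
    (hερ : 6 * ((((F.P Kt).d - 1 : ℕ)) : ℝ) * (F.P Kt).L * ν.εreg ≤ ρ'') {δ : ℝ} (hδ : 0 < δ) (hδρ : 6 * ((((F.P Kt).d - 1 : ℕ)) : ℝ) * (F.P Kt).L ^ k * δ ≤ ρ'')
    (ext : GaugeField (F.P Kt) k SU2 → GaugeField (F.P Kt) k SU2) (hext : ∀ W, ext W = extend Λ (shellGauge W lo hi) W)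
    {K : Set (GaugeField (F.P Kt) k SU2)} (hK : IsCompact K) {𝓐₀ : ℝ} (h𝓐₀ : 1 < 𝓐₀)
    -- the three CLASS facts: a closed-reading class `reg'` containing the closure of NODE 00's class, on which the `𝐁`-restricted averages are continuous
    (reg' : Set (GaugeField (F.P Kt) 0 SU2)) (hreg' : IsClosed reg') (hcl : closure (Node00.regMSCoPOfRecord F 2 ν Kt k (maxDomT ν.M₁ Z)) ⊆ reg')
    (hDreg' : ContinuousOn (fun (U : GaugeField (F.P Kt) 0 SU2) (i : Fin (constrCard 𝔹 k)) =>
      ((avgFamily (Node00.avOfRecord F 2 Kt) U ((constrEnum 𝔹 k).symm i).1 ((constrEnum 𝔹 k).symm i).2.1 : SU2) : Matrix (Fin 2) (Fin 2) ℂ)) reg')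
    (hbase : ∀ Vk ∈ K, ∃ (U₀ : GaugeField (F.P Kt) 0 SU2) (S : Submodule ℂ (VecField (F.P Kt) 0 (EuclideanSpace ℂ (Fin 3)))) (path : Site (F.P Kt) 0 → List (LStep (F.P Kt) 0))
        (a : S → ℂ) (Φ₀ : S → Fin (constrCard 𝔹 k) → EuclideanSpace ℂ (Fin 3)),
      IsMinimizer (Node00.avOfRecord F 2 Kt) (Node00.regMSCoPOfRecord F 2 ν Kt k (maxDomT ν.M₁ Z)) 𝔹
        (avgFamily (Node00.avOfRecord F 2 Kt) (qsstarGIter0 k (ext Vk))) U₀ ∧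
      -- the DATUM's scale-`k` regularity on `Z` (the p. 193 extension `Ṽ_k = ext V_k`: `B15ShellGauge193Local.dist1_plaqHol_extend_shellGauge_le`) — replaces BOTH (0.4) guard rows
      PlaqSmallOn (plaqsInside (pts k Z)) δ (ext Vk) ∧
      -- the slice is the axial slice of a rooted forest: (F1), (F2), (F3)
      (∀ x, ∀ s ∈ path x, ∃ x' x'' : Site (F.P Kt) 0, path x'' = path x' ++ [s] ∧
        (s.fwd = true → s.bond.src = x' ∧ s.bond.tgt = x'') ∧ (s.fwd = false → s.bond.src = x'' ∧ s.bond.tgt = x')) ∧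
      (∀ j, j ≤ k → ∀ c ∈ bondsOf (𝔹 j), path (embIter j c.src) = [] ∧ path (embIter j c.tgt) = []) ∧
      (∀ X : VecField (F.P Kt) 0 (EuclideanSpace ℂ (Fin 3)), X ∈ S ↔ ∀ x, ∀ s ∈ path x, X s.bond = 0) ∧
      (∀ X : S, a X = ∑ p : Plaq (F.P Kt) 0, (1 - (expMulC (X : VecField (F.P Kt) 0 (EuclideanSpace ℂ (Fin 3))) (coeField U₀) ⟨p.src, p.μ⟩ *
        expMulC (X : VecField (F.P Kt) 0 (EuclideanSpace ℂ (Fin 3))) (coeField U₀) ⟨p.src.shift p.μ, p.ν⟩ *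
        Matrix.adjugate (expMulC (X : VecField (F.P Kt) 0 (EuclideanSpace ℂ (Fin 3))) (coeField U₀) ⟨p.src.shift p.ν, p.μ⟩) *
        Matrix.adjugate (expMulC (X : VecField (F.P Kt) 0 (EuclideanSpace ℂ (Fin 3))) (coeField U₀) ⟨p.src, p.ν⟩)).trace / 2)) ∧
      (∀ (X : S) i, Φ₀ X i = logCoordC (star ((avgFamily (Node00.avOfRecord F 2 Kt) (qsstarGIter0 k (ext Vk))
        ((constrEnum 𝔹 k).symm i).1 ((constrEnum 𝔹 k).symm i).2.1 : SU2) : Matrix (Fin 2) (Fin 2) ℂ) *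
        iterMh ((constrEnum 𝔹 k).symm i).1 (expMulC (X : VecField (F.P Kt) 0 (EuclideanSpace ℂ (Fin 3))) (coeField U₀)) ((constrEnum 𝔹 k).symm i).2.1)) ∧
      -- DISPLAYED ([15] (45), VELOCITY currency): a REAL right inverse of the linearised multi-scale averaging from the slice — intrinsic (group-valued averages at the constrained bonds)
      (∀ τ : Fin (constrCard 𝔹 k) → EuclideanSpace ℝ (Fin 3), ∃ p : VecField (F.P Kt) 0 E3, cplxVec p ∈ S ∧
        ∀ i : Fin (constrCard 𝔹 k), HasDerivAt (fun s : ℝ => ((avgFamily (Node00.avOfRecord F 2 Kt) (expMul su2Chart (s • p) U₀)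
          ((constrEnum 𝔹 k).symm i).1 ((constrEnum 𝔹 k).symm i).2.1 : SU2) : Matrix (Fin 2) (Fin 2) ℂ))
          (((avgFamily (Node00.avOfRecord F 2 Kt) (qsstarGIter0 k (ext Vk)) ((constrEnum 𝔹 k).symm i).1
            ((constrEnum 𝔹 k).symm i).2.1 : SU2) : Matrix (Fin 2) (Fin 2) ℂ) * ∑ b : Fin 3, ((τ i b : ℝ) : ℂ) • genE b) 0) ∧
      -- DISPLAYED ((β), REAL currency, kernel in `DΦ₀(0)` currency): positivity of the real second variation of the Lagrangian on the real kernel of the linearised constraint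
      (∀ ℓ₀ : (Fin (constrCard 𝔹 k) → EuclideanSpace ℂ (Fin 3)) →L[ℂ] ℂ, fderiv ℂ a 0 = ℓ₀.comp (fderiv ℂ Φ₀ 0) →
        ∀ (p : VecField (F.P Kt) 0 E3) (hp : cplxVec p ∈ S), p ≠ 0 → fderiv ℂ Φ₀ 0 ⟨cplxVec p, hp⟩ = 0 →
          0 < deriv (deriv (fun t : ℝ => wilsonAction4 (expMul su2Chart (t • p) U₀) - (ℓ₀ (Φ₀ ((t : ℂ) • ⟨cplxVec p, hp⟩))).re)) 0) ∧
      -- DISPLAYED (T1@q₀): Theorem 1 at the base datum — the DATUM-PRESERVING (central at the 𝐁-towers) orbit of `U₀` is the unique minimal orbit over `reg'`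
      (∀ U ∈ reg', AgreeOn 𝔹 (avgFamily (Node00.avOfRecord F 2 Kt) U) (avgFamily (Node00.avOfRecord F 2 Kt) (qsstarGIter0 k (ext Vk))) →
        wilsonAction4 U ≤ wilsonAction4 U₀ →
          ∃ u : GaugeTransf (F.P Kt) 0 SU2, (∀ j, j ≤ k → ∀ b ∈ bondsOf (𝔹 j), toMS u j b.src = toMS u j b.tgt ∧ ∀ g : SU2, toMS u j b.src * g = g * toMS u j b.src) ∧ gaugeAct u U = U₀)) :
    ∃ R : ℝ, 0 < R ∧ ∀ Vk ∈ K,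
      ∃ Ũ : VecField (F.P Kt) k (EuclideanSpace ℂ (Fin 3)) × VecField (F.P Kt) k (EuclideanSpace ℂ (Fin 3)) → PBond (F.P Kt) 0 → Matrix (Fin 2) (Fin 2) ℂ,
        (∀ b i j, DifferentiableOn ℂ (fun z => Ũ z b i j) (ball 0 R)) ∧
        (∀ z ∈ ball (0 : VecField (F.P Kt) k (EuclideanSpace ℂ (Fin 3)) × VecField (F.P Kt) k (EuclideanSpace ℂ (Fin 3))) R, ∀ b i j, ‖Ũ z b i j‖ ≤ 𝓐₀) ∧
        ∀ p B' : VecField (F.P Kt) k E3, ‖p‖ < R → ‖B'‖ < R → ∃ U' : GaugeField (F.P Kt) 0 SU2,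
          (∀ b, Ũ (cplxVec p, cplxVec B') b = ((U' b : SU2) : Matrix (Fin 2) (Fin 2) ℂ)) ∧
            IsMinimizer (Node00.avOfRecord F 2 Kt) (Node00.regMSCoPOfRecord F 2 ν Kt k (maxDomT ν.M₁ Z)) 𝔹
              (avgFamily (Node00.avOfRecord F 2 Kt) (qsstarGIter0 k (expMul su2Chart B' (ext (expMul su2Chart p Vk))))) U' := by
  subst h𝔹Z
  have hk : k ≤ (F.P Kt).m + (F.P Kt).K := Nat.le_of_succ_le hkK
  exact hMin_atRecord_of_node00Letters_thm1AtBase_central_of_guardOn ν Kt k (maxDomT ν.M₁ Z) Λ lo hi (Bj ν.M₁ Z k) (fun _ hj => Bj_of_gt hj) hk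
    ext hext hK h𝓐₀ reg' hreg' hcl hDreg'
    (fun Vk hVk => by
      obtain ⟨U₀, S, path, a, Φ₀, hmin, hreg, hF1, hF2, hF3, ha, hΦ₀, hH, hposN, hT1⟩ := hbase Vk hVk
      exact ⟨U₀, S, path, a, Φ₀, hmin,
        guardOn_towerRegion_Bj_qsstarGIter0_of_plaqSmallOn_Z ν Kt hd Z hkK hM4 hdiv hZblk hδ hreg hsbU hδρ,
        guardOn_towerRegion_Bj_of_mem_class ν Kt Z hkK hM4 hdiv hε hsbU hερ hmin.1,
        hF1, hF2, hF3, ha, hΦ₀, hH, hposN, hT1⟩)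

end Summit.QuantumFields.YangMills.BalabanUVNodes.N12MinimiserFamilyOfClassTowerGuards

end
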